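import Summits.QuantumFields.BalabanUV.Beta.D1BFx.KernelMassCalculus

/-!
# `BalabanUV.Beta.D1BFx.KernelMassTotal` — road «BF-x» for binder row D1, slot (K), (II)-rows (C1)(C2), FILE α2 «MASS-CALC ∕ TOTAL»: **THE TOTAL MASS
# `Σ_{(x,z)} Σ_{ab}|K x z a b|` AGAINST ROW∕COLUMN MASSES OF THE FACTORS, AND THE VERTEX SANDWICH** — two localised vertices around a θ-weighted leg
# have total mass `≤ ω·ω′·M_B·Zl D (κ−θ)·e^{−θ|c−c′|₁}`: ONE lattice constant per word, the centres separated at the leg's rate (W-1 l.43312 (F2))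

HONEST DEPENDENCY (cell records, verbatim): «continuum YM on T⁴ ⇐ BetaPertH ∧ nine spine estimates (0/9 proved); BetaPertH ⇐ (D1) ∧ (D4) ∧
CAP+tail; G-an2-4 gates asym, D1 and NE2/3/4.»  HONEST FRAMING (cell contract, verbatim): «discharging `BetaPertH` makes Bałaban's UV stability
UNCONDITIONAL — a real constructive-QFT result; it is NOT the continuum limit and NOT the Clay problem.»  THIS MODULE DISCHARGES NOTHING of the
wall: [folklore] `ℓ¹` bookkeeping (Tonelli for nonnegative double series — Mathlib's `summable_prod_of_nonneg` ∕ `Summable.tsum_prod'` ∕ `Summable.tsum_comm'`,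
the triangle inequality for `|·|₁`) over α1's predicates; generic `D`, `F`.  No definition, no `def … : Prop`, nothing cited, 0 sorry.  0 root-level binders
of row D1 discharged (hW ∕ hR-sockets ∕ hSX-socket ∕ D1Tel ∕ D1Rep = 0); (K) NOT closed; (C1)(C2) NOT closed here; NOT D1, NOT `BetaPertH`, NOT continuum, NOT Clay.

ABSOLUTE RULE (cell charter, verbatim): «No internally-minted statement may enter as a cited fact. Every hypothesis is either kernel-proved in
this package or a verbatim quotation of a PUBLISHED theorem with page reference. The manuscript(s) under audit are NOT citable for their own
disputed steps — they are the thing under adjudication; programme-internal (2001/route/tribunal) claims are never citable.»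

WHY.  The (C2) letter the END displays is a TOTAL (block) mass `Σ'_{(p,q)} Σ_{g f} |blk W … p q g f| ≤ mW·e^{−κ|z|₁}`; every P4b word is
`(outer leg) ∘ (vertex at block y) ∘ (middle leg) ∘ (vertex at block y′) ∘ (outer leg)`; α1 multiplies the legs' masses, this file closes the word:
`totMass_comp3` puts the outer legs' column∕row masses around a total mass, `totMass_sandwich` produces that total mass from the two vertices' envelopes
(`ω, ω′ ≍ n⁻⁴` each at the road) and the middle leg's θ-weighted row mass, paying `Zl D (κ−θ) ≍ n⁴` ONCE and keeping `e^{−θ|c−c′|₁}`.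

CONTENT (all [folklore]).
* §1 `totMass_iff` (product form ↔ iterated form), `totMass_nonneg ∕ rowMass ∕ trK ∕ colMass ∕ mono ∕ add ∕ smul ∕ neg ∕ sub`.
* §2 **`totMass_comp_right`** (`TotMass V M_V → RowMass C 0 r_C → TotMass (V∘C) (M_V·r_C)`), **`totMass_comp_left`** (`ColMass A 0 c_A → TotMass V M_V →
  TotMass (A∘V) (c_A·M_V)`), `totMass_comp3`.
* §3 `weight_split`, **`totMass_sandwich`**: `RowMass V 0 ρ_V` (convergence) ∧ `Σ'_u rowFn V 0 u u′ ≤ ω·e^{−κ|u′−c|₁}` (column envelope) ∧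
  `RowMass B θ M_B` ∧ `0 ≤ θ < κ` ∧ `ColMass V′ 0 γ_{V′}` (convergence) ∧ `Σ'_{v′} rowFn V′ 0 v v′ ≤ ω′·e^{−κ|v−c′|₁}` (row envelope) ⟹
  `TotMass (V∘B∘V′) (ω·ω′·M_B·Zl D (κ−θ)·e^{−θ|c−c′|₁})`.
NOT HERE: the `D = 4` sandwich shapes `dSw ∕ jetCw ∕ jetRw ∕ jetRCw` and the road's vertices `gW w` (δ), the leg masses (γ).
Unit `b2b-balaban-gan24-formalise-leaf-05` (gen 54), G-an2-4 swarm leaf prover 05, road «BF-x» (C1)(C2) count owner; INTENT «MASS-CALC» (journal).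
-/


noncomputable section

namespace Summit.QuantumFields.BalabanUV.Beta.D1BFx.KernelMassTotal

open scoped BigOperators
open Finset
open Literature.MathematicalPhysics.QuantumFieldTheory.Balaban1983to89
open Literature.MathematicalPhysics.QuantumFieldTheory.Balaban1983to89.Beta
open B12Sec2to5 (l1 l1_nonneg)
open ExpKernelCalculus (Site MKer comp Zl Zl_pos l1_sub_triangle l1_sub_symm summable_exp_shift summable_exp_shift' tsum_exp_shift')
open Summit.QuantumFields.BalabanUV.Beta.TameKernelCalculus (trK trK_comp trK_trK)
open Summit.QuantumFields.BalabanUV.Beta.D1BFx.KernelMassCalculus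

variable {D : ℕ} {F : Type*} [Fintype F]
variable {K V V' A B C : MKer D F} {θ M M' MV MA MB cA rC : ℝ}

/-! ## §1 The total mass in iterated form -/

/-- [folklore] **ITERATED FORM**: `TotMass K M ↔` every row of `rowFn K 0` is summable, the row sums are summable, and `Σ'_x Σ'_y rowFn K 0 x y ≤ M`
(Tonelli for nonnegative families, `summable_prod_of_nonneg`). -/
theorem totMass_iff : TotMass K M ↔
    (∀ x, Summable (rowFn K 0 x)) ∧ (Summable fun x => ∑' y, rowFn K 0 x y) ∧ ∑' x, ∑' y, rowFn K 0 x y ≤ M := by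
  have hf0 : 0 ≤ fun p : Site D × Site D => ∑ a, ∑ b, |K p.1 p.2 a b| := fun _ =>
    Finset.sum_nonneg fun _ _ => Finset.sum_nonneg fun _ _ => abs_nonneg _
  have e : ∀ x y, rowFn K 0 x y = ∑ a, ∑ b, |K x y a b| := fun x y => rowFn_zero K x y
  unfold TotMass
  constructor
  · rintro ⟨hs, hle⟩
    obtain ⟨h1, h2⟩ := (summable_prod_of_nonneg hf0).1 hs
    refine ⟨fun x => (h1 x).congr fun y => (e x y).symm, h2.congr fun x => tsum_congr fun y => (e x y).symm, ?_⟩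
    have h3 := hs.tsum_prod' h1
    simp_rw [e]
    rw [← h3]
    exact hle
  · rintro ⟨h1, h2, hle⟩
    have h1' : ∀ x, Summable fun y => ∑ a, ∑ b, |K x y a b| := fun x => (h1 x).congr fun y => e x y
    have h2' : Summable fun x => ∑' y, ∑ a, ∑ b, |K x y a b| := h2.congr fun x => tsum_congr fun y => e x y
    have hs : Summable fun p : Site D × Site D => ∑ a, ∑ b, |K p.1 p.2 a b| := (summable_prod_of_nonneg hf0).2 ⟨h1', h2'⟩
    refine ⟨hs, ?_⟩
    rw [hs.tsum_prod' h1']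
    simp_rw [← e]; exact hle

/-- [folklore] The bound is nonnegative. -/
theorem totMass_nonneg (h : TotMass K M) : 0 ≤ M :=
  (tsum_nonneg fun _ => Finset.sum_nonneg fun _ _ => Finset.sum_nonneg fun _ _ => abs_nonneg _).trans h.2

/-- [folklore] **A TOTAL MASS BOUNDS EVERY ROW MASS** (`θ = 0`). -/
theorem totMass_rowMass (h : TotMass K M) : RowMass K 0 M := by
  obtain ⟨h1, h2, hle⟩ := totMass_iff.1 h
  intro x
  exact ⟨h1 x, (h2.le_tsum x fun x' _ => tsum_nonneg fun y => rowFn_nonneg K 0 x' y).trans hle⟩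

/-- [folklore] Transposition preserves the total mass. -/
theorem totMass_trK (h : TotMass K M) : TotMass (trK K) M := by
  obtain ⟨hs, hle⟩ := h
  have e : (fun p : Site D × Site D => ∑ a, ∑ b, |trK K p.1 p.2 a b|)
      = (fun p : Site D × Site D => ∑ a, ∑ b, |K p.1 p.2 a b|) ∘ (Equiv.prodComm (Site D) (Site D)) := by
    funext p
    simp only [Function.comp, Equiv.prodComm_apply, Prod.swap, trK]
    exact Finset.sum_comm
  refine ⟨?_, ?_⟩
  · rw [e]; exact (Equiv.summable_iff _).2 hs
  · rw [e]
    have h2 := Equiv.tsum_eq (Equiv.prodComm (Site D) (Site D)) (fun p : Site D × Site D => ∑ a, ∑ b, |K p.1 p.2 a b|)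
    show ∑' c, (fun p : Site D × Site D => ∑ a, ∑ b, |K p.1 p.2 a b|) ((Equiv.prodComm (Site D) (Site D)) c) ≤ M
    exact h2.le.trans hle

/-- [folklore] … hence every COLUMN mass too. -/
theorem totMass_colMass (h : TotMass K M) : ColMass K 0 M :=
  colMass_iff_rowMass_trK.2 (totMass_rowMass (totMass_trK h))

/-- [folklore] Monotonicity. -/
theorem totMass_mono (h : TotMass K M) (hM : M ≤ M') : TotMass K M' := ⟨h.1, h.2.trans hM⟩

/-- [folklore] Sum. -/
theorem totMass_add {L : MKer D F} (hK : TotMass K M) (hL : TotMass L M') : TotMass (K + L) (M + M') := by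
  have hle : ∀ p : Site D × Site D, ∑ a, ∑ b, |(K + L) p.1 p.2 a b| ≤ (∑ a, ∑ b, |K p.1 p.2 a b|) + ∑ a, ∑ b, |L p.1 p.2 a b| :=
    fun p => sum_abs_add_le K L p.1 p.2
  have hs : Summable fun p : Site D × Site D => ∑ a, ∑ b, |(K + L) p.1 p.2 a b| :=
    (hK.1.add hL.1).of_nonneg_of_le (fun p => Finset.sum_nonneg fun _ _ => Finset.sum_nonneg fun _ _ => abs_nonneg _) hle
  refine ⟨hs, (hs.tsum_le_tsum hle (hK.1.add hL.1)).trans ?_⟩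
  rw [hK.1.tsum_add hL.1]
  exact add_le_add hK.2 hL.2

/-- [folklore] Scalar multiple. -/
theorem totMass_smul (hK : TotMass K M) (c : ℝ) : TotMass (c • K) (|c| * M) := by
  have e : (fun p : Site D × Site D => ∑ a, ∑ b, |(c • K) p.1 p.2 a b|) = fun p => |c| * ∑ a, ∑ b, |K p.1 p.2 a b| := by
    funext p
    simp only [Pi.smul_apply, smul_eq_mul, abs_mul]
    simp_rw [Finset.mul_sum]
  refine ⟨?_, ?_⟩
  · rw [e]; exact hK.1.mul_left _
  · rw [e, tsum_mul_left]; exact mul_le_mul_of_nonneg_left hK.2 (abs_nonneg c)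

/-- [folklore] Negation. -/
theorem totMass_neg (hK : TotMass K M) : TotMass (-K) M := by
  have e : (fun p : Site D × Site D => ∑ a, ∑ b, |(-K) p.1 p.2 a b|) = fun p => ∑ a, ∑ b, |K p.1 p.2 a b| := by
    funext p; simp only [Pi.neg_apply, abs_neg]
  unfold TotMass; rw [e]; exact hK

/-- [folklore] Difference. -/
theorem totMass_sub {L : MKer D F} (hK : TotMass K M) (hL : TotMass L M') : TotMass (K - L) (M + M') := by
  rw [sub_eq_add_neg]; exact totMass_add hK (totMass_neg hL)

/-! ## §2 Total mass of a composition: the outer factor contributes a row∕column mass -/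

/-- [folklore] **`TotMass V M_V → RowMass C 0 r_C → TotMass (V∘C) (M_V·r_C)`** (the right leg contributes its plain row mass). -/
theorem totMass_comp_right (hV : TotMass V MV) (hC : RowMass C 0 rC) : TotMass (comp V C) (MV * rC) := by
  obtain ⟨hV1, hV2, hVle⟩ := totMass_iff.1 hV
  have hVrow : RowMass V 0 MV := totMass_rowMass hV
  -- row by row, as in `rowMass_comp`, but keeping the row sum `R x := Σ'_y rowFn V 0 x y`
  have hprod : ∀ x z, Summable fun y => rowFn V 0 x y * rowFn C 0 y z := fun x z =>
    ((hV1 x).mul_right rC).of_nonneg_of_le (fun y => mul_nonneg (rowFn_nonneg _ _ _ _) (rowFn_nonneg _ _ _ _))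
      (fun y => mul_le_mul_of_nonneg_left (hC.rowFn_le y z) (rowFn_nonneg _ _ _ _))
  have hrow : ∀ x, ∀ S : Finset (Site D), ∑ z ∈ S, rowFn (comp V C) 0 x z ≤ (∑' y, rowFn V 0 x y) * rC := by
    intro x S
    have h1 : ∑ z ∈ S, rowFn (comp V C) 0 x z ≤ ∑ z ∈ S, ∑' y, rowFn V 0 x y * rowFn C 0 y z :=
      Finset.sum_le_sum fun z _ => rowFn_comp_le le_rfl (hprod x z)
    have h2 : ∑ z ∈ S, ∑' y, rowFn V 0 x y * rowFn C 0 y z = ∑' y, rowFn V 0 x y * ∑ z ∈ S, rowFn C 0 y z := by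
      rw [← Summable.tsum_finsetSum (fun z _ => hprod x z)]
      exact tsum_congr fun y => by rw [Finset.mul_sum]
    have h3 : ∀ y, rowFn V 0 x y * ∑ z ∈ S, rowFn C 0 y z ≤ rowFn V 0 x y * rC := fun y =>
      mul_le_mul_of_nonneg_left (((hC y).1.sum_le_tsum S fun z _ => rowFn_nonneg _ _ _ _).trans (hC y).2) (rowFn_nonneg _ _ _ _)
    have hs3 : Summable fun y => rowFn V 0 x y * ∑ z ∈ S, rowFn C 0 y z := by
      have : (fun y => rowFn V 0 x y * ∑ z ∈ S, rowFn C 0 y z) = fun y => ∑ z ∈ S, rowFn V 0 x y * rowFn C 0 y z := by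
        funext y; rw [Finset.mul_sum]
      rw [this]; exact summable_sum fun z _ => hprod x z
    rw [h2] at h1
    refine h1.trans ((hs3.tsum_le_tsum h3 ((hV1 x).mul_right rC)).trans (le_of_eq ?_))
    rw [tsum_mul_right]
  have hsum : ∀ x, Summable (rowFn (comp V C) 0 x) := fun x => summable_of_sum_le (fun z => rowFn_nonneg _ _ _ _) (hrow x)
  have hle : ∀ x, ∑' z, rowFn (comp V C) 0 x z ≤ (∑' y, rowFn V 0 x y) * rC := fun x =>
    Real.tsum_le_of_sum_le (fun z => rowFn_nonneg _ _ _ _) (hrow x)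
  have hs2 : Summable fun x => ∑' z, rowFn (comp V C) 0 x z :=
    (hV2.mul_right rC).of_nonneg_of_le (fun x => tsum_nonneg fun z => rowFn_nonneg _ _ _ _) hle
  refine totMass_iff.2 ⟨hsum, hs2, (hs2.tsum_le_tsum hle (hV2.mul_right rC)).trans ?_⟩
  rw [tsum_mul_right]
  exact mul_le_mul_of_nonneg_right hVle hC.nonneg

/-- [folklore] **`ColMass A 0 c_A → TotMass V M_V → TotMass (A∘V) (c_A·M_V)`** (the left leg contributes its plain column mass; by transposition). -/
theorem totMass_comp_left (hA : ColMass A 0 cA) (hV : TotMass V MV) : TotMass (comp A V) (cA * MV) := by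
  have h := totMass_comp_right (totMass_trK hV) (colMass_iff_rowMass_trK.1 hA)
  rw [← trK_comp] at h
  have h' := totMass_trK h
  rw [trK_trK, mul_comm] at h'
  exact h'

/-- [folklore] **THE THREE-FACTOR FORM**: `ColMass A 0 c_A → TotMass V M_V → RowMass C 0 r_C → TotMass (A∘V∘C) (c_A·M_V·r_C)`. -/
theorem totMass_comp3 (hA : ColMass A 0 cA) (hV : TotMass V MV) (hC : RowMass C 0 rC) :
    TotMass (comp (comp A V) C) (cA * MV * rC) :=
  totMass_comp_right (totMass_comp_left hA hV) hC

/-! ## §3 The vertex sandwich: two localised vertices around a θ-weighted leg -/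

omit [Fintype F] in
/-- [folklore] The weight split behind the sandwich: for `0 ≤ θ ≤ κ`,
`e^{−κ|u′−c|₁}·e^{−κ|v−c′|₁} ≤ e^{−(κ−θ)|u′−c|₁}·e^{−θ|c−c′|₁}·e^{θ|u′−v|₁}` (`|c−c′|₁ ≤ |c−u′|₁ + |u′−v|₁ + |v−c′|₁`). -/
theorem weight_split {κ θ : ℝ} (hθ : 0 ≤ θ) (hθκ : θ ≤ κ) (u' v c c' : Site D) :
    Real.exp (-κ * l1 (u' - c)) * Real.exp (-κ * l1 (v - c'))
      ≤ Real.exp (-(κ - θ) * l1 (u' - c)) * Real.exp (-θ * l1 (c - c')) * Real.exp (θ * l1 (u' - v)) := by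
  rw [← Real.exp_add, ← Real.exp_add, ← Real.exp_add, Real.exp_le_exp]
  have h1 : l1 (c - c') ≤ l1 (c - u') + l1 (u' - c') := l1_sub_triangle c u' c'
  have h2 : l1 (u' - c') ≤ l1 (u' - v) + l1 (v - c') := l1_sub_triangle u' v c'
  have h3 : l1 (c - u') = l1 (u' - c) := l1_sub_symm c u'
  have hA := l1_nonneg (u' - c)
  have hB := l1_nonneg (v - c')
  nlinarith

/-- [folklore] **THE VERTEX SANDWICH**: a leg `B` with θ-weighted row mass `M_B` between two vertices — `V` with COLUMN sums `≤ ω·e^{−κ|u′−c|₁}`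
(localised at `c`) and `V′` with ROW sums `≤ ω′·e^{−κ|v−c′|₁}` (localised at `c′`), `0 ≤ θ < κ` — has TOTAL mass
`≤ ω·ω′·M_B·Zl D (κ−θ)·e^{−θ|c−c′|₁}`: ONE lattice constant for the whole word, and the separation of the two centres at the leg's rate `θ`
(the row summability of `V` and the column summability of `V′` are used only for convergence). -/
theorem totMass_sandwich {ω ω' κ ρV γV' : ℝ} {c c' : Site D}
    (hVrow : RowMass V 0 ρV) (hVcol : ∀ u', (Summable fun u => rowFn V 0 u u') ∧ ∑' u, rowFn V 0 u u' ≤ ω * Real.exp (-κ * l1 (u' - c)))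
    (hB : RowMass B θ MB) (hθ : 0 ≤ θ) (hθκ : θ < κ)
    (hV'col : ColMass V' 0 γV') (hV'row : ∀ v, Summable (rowFn V' 0 v) ∧ ∑' v', rowFn V' 0 v v' ≤ ω' * Real.exp (-κ * l1 (v - c'))) :
    TotMass (comp (comp V B) V') (ω * ω' * MB * Zl D (κ - θ) * Real.exp (-θ * l1 (c - c'))) := by
  have hB0 : RowMass B 0 MB := hB.mono hθ le_rfl
  have hMB := hB.nonneg
  have hω : 0 ≤ ω := by
    have h := (hVcol c).2
    exact nonneg_of_mul_nonneg_left ((tsum_nonneg fun u => rowFn_nonneg V 0 u c).trans h) (Real.exp_pos _)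
  have hω' : 0 ≤ ω' := by
    have h := (hV'row c').2
    exact nonneg_of_mul_nonneg_left ((tsum_nonneg fun v => rowFn_nonneg V' 0 c' v).trans h) (Real.exp_pos _)
  -- envelopes
  set e : Site D → ℝ := fun u' => Real.exp (-κ * l1 (u' - c)) with he
  set e' : Site D → ℝ := fun v => Real.exp (-κ * l1 (v - c')) with he'
  have he1 : ∀ u', e u' ≤ 1 := fun u' => by
    rw [he]; exact Real.exp_le_one_iff.2 (by nlinarith [l1_nonneg (u' - c), hθ, hθκ])
  have he'1 : ∀ v, e' v ≤ 1 := fun v => by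
    rw [he']; exact Real.exp_le_one_iff.2 (by nlinarith [l1_nonneg (v - c'), hθ, hθκ])
  -- Φ(u′) := Σ'_v rowFn B 0 u′ v · e′(v), and its θ-bound
  have hΦs : ∀ u', Summable fun v => rowFn B 0 u' v * e' v := fun u' =>
    ((hB0 u').1).of_nonneg_of_le (fun v => mul_nonneg (rowFn_nonneg _ _ _ _) (Real.exp_pos _).le)
      (fun v => mul_le_of_le_one_right (rowFn_nonneg _ _ _ _) (he'1 v))
  have hΦle : ∀ u', e u' * ∑' v, rowFn B 0 u' v * e' v ≤ MB * Real.exp (-θ * l1 (c - c')) * Real.exp (-(κ - θ) * l1 (u' - c)) := by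
    intro u'
    have hpt : ∀ v, e u' * (rowFn B 0 u' v * e' v)
        ≤ rowFn B θ u' v * (Real.exp (-θ * l1 (c - c')) * Real.exp (-(κ - θ) * l1 (u' - c))) := fun v => by
      have hw := weight_split hθ hθκ.le u' v c c'
      have hr : rowFn B θ u' v = rowFn B 0 u' v * Real.exp (θ * l1 (u' - v)) := by rw [rowFn_zero]; rfl
      rw [hr]
      calc e u' * (rowFn B 0 u' v * e' v) = rowFn B 0 u' v * (e u' * e' v) := by ring
        _ ≤ rowFn B 0 u' v * (Real.exp (-(κ - θ) * l1 (u' - c)) * Real.exp (-θ * l1 (c - c')) * Real.exp (θ * l1 (u' - v))) :=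
            mul_le_mul_of_nonneg_left hw (rowFn_nonneg _ _ _ _)
        _ = _ := by ring
    rw [← tsum_mul_left]
    calc ∑' v, e u' * (rowFn B 0 u' v * e' v)
        ≤ ∑' v, rowFn B θ u' v * (Real.exp (-θ * l1 (c - c')) * Real.exp (-(κ - θ) * l1 (u' - c))) :=
          ((hΦs u').mul_left _).tsum_le_tsum hpt ((hB u').1.mul_right _)
      _ = (∑' v, rowFn B θ u' v) * (Real.exp (-θ * l1 (c - c')) * Real.exp (-(κ - θ) * l1 (u' - c))) := tsum_mul_right
      _ ≤ MB * (Real.exp (-θ * l1 (c - c')) * Real.exp (-(κ - θ) * l1 (u' - c))) :=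
          mul_le_mul_of_nonneg_right (hB u').2 (by positivity)
      _ = _ := by ring
  -- the composition `VB` has bounded, summable rows
  have hVB : RowMass (comp V B) 0 (ρV * MB) := rowMass_comp hVrow hB0 le_rfl
  -- row `x` of the word against a finite set of columns
  have hprodVB : ∀ x v, Summable fun u' => rowFn V 0 x u' * rowFn B 0 u' v := fun x v =>
    ((hVrow x).1.mul_right MB).of_nonneg_of_le (fun u' => mul_nonneg (rowFn_nonneg _ _ _ _) (rowFn_nonneg _ _ _ _))
      (fun u' => mul_le_mul_of_nonneg_left (hB0.rowFn_le u' v) (rowFn_nonneg _ _ _ _))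
  have hprodW : ∀ x z, Summable fun v => rowFn (comp V B) 0 x v * rowFn V' 0 v z := fun x z =>
    ((hV'col z).1.mul_left (ρV * MB)).of_nonneg_of_le (fun v => mul_nonneg (rowFn_nonneg _ _ _ _) (rowFn_nonneg _ _ _ _))
      (fun v => mul_le_mul_of_nonneg_right (hVB.rowFn_le x v) (rowFn_nonneg _ _ _ _))
  -- R(x) := Σ'_{u′} rowFn V 0 x u′ · (ω′ · Φ u′)
  set Φ : Site D → ℝ := fun u' => ∑' v, rowFn B 0 u' v * e' v with hΦ
  have hΦ0 : ∀ u', 0 ≤ Φ u' := fun u' => tsum_nonneg fun v => mul_nonneg (rowFn_nonneg _ _ _ _) (Real.exp_pos _).le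
  have hΦB : ∀ u', Φ u' ≤ MB := fun u' => by
    have h1 : e c ≤ 1 := he1 c
    have := (hΦs u').tsum_le_tsum (fun v => mul_le_of_le_one_right (rowFn_nonneg _ _ _ _) (he'1 v)) (hB0 u').1
    exact this.trans (hB0 u').2
  have hRs : ∀ x, Summable fun u' => rowFn V 0 x u' * (ω' * Φ u') := fun x =>
    ((hVrow x).1.mul_right (ω' * MB)).of_nonneg_of_le (fun u' => mul_nonneg (rowFn_nonneg _ _ _ _) (mul_nonneg hω' (hΦ0 u')))
      (fun u' => mul_le_mul_of_nonneg_left (mul_le_mul_of_nonneg_left (hΦB u') hω') (rowFn_nonneg _ _ _ _))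
  have hrow : ∀ x, ∀ S : Finset (Site D), ∑ z ∈ S, rowFn (comp (comp V B) V') 0 x z ≤ ∑' u', rowFn V 0 x u' * (ω' * Φ u') := by
    intro x S
    -- step 1: through the outer composition
    have h1 : ∑ z ∈ S, rowFn (comp (comp V B) V') 0 x z ≤ ∑' v, rowFn (comp V B) 0 x v * ∑ z ∈ S, rowFn V' 0 v z := by
      have ha : ∑ z ∈ S, rowFn (comp (comp V B) V') 0 x z ≤ ∑ z ∈ S, ∑' v, rowFn (comp V B) 0 x v * rowFn V' 0 v z :=
        Finset.sum_le_sum fun z _ => rowFn_comp_le le_rfl (hprodW x z)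
      rw [← Summable.tsum_finsetSum (fun z _ => hprodW x z)] at ha
      refine ha.trans (le_of_eq (tsum_congr fun v => by rw [Finset.mul_sum]))
    -- step 2: the row envelope of `V′`
    have h2 : ∀ v, rowFn (comp V B) 0 x v * ∑ z ∈ S, rowFn V' 0 v z ≤ rowFn (comp V B) 0 x v * (ω' * e' v) := fun v =>
      mul_le_mul_of_nonneg_left (((hV'row v).1.sum_le_tsum S fun z _ => rowFn_nonneg _ _ _ _).trans (hV'row v).2) (rowFn_nonneg _ _ _ _)
    have hs2 : Summable fun v => rowFn (comp V B) 0 x v * ∑ z ∈ S, rowFn V' 0 v z := by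
      have : (fun v => rowFn (comp V B) 0 x v * ∑ z ∈ S, rowFn V' 0 v z) = fun v => ∑ z ∈ S, rowFn (comp V B) 0 x v * rowFn V' 0 v z := by
        funext v; rw [Finset.mul_sum]
      rw [this]; exact summable_sum fun z _ => hprodW x z
    have hs2' : Summable fun v => rowFn (comp V B) 0 x v * (ω' * e' v) :=
      ((hVB x).1.mul_right ω').of_nonneg_of_le (fun v => mul_nonneg (rowFn_nonneg _ _ _ _) (mul_nonneg hω' (Real.exp_pos _).le))
        (fun v => mul_le_mul_of_nonneg_left (mul_le_of_le_one_right hω' (he'1 v)) (rowFn_nonneg _ _ _ _))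
    have h3 : ∑' v, rowFn (comp V B) 0 x v * ∑ z ∈ S, rowFn V' 0 v z ≤ ∑' v, rowFn (comp V B) 0 x v * (ω' * e' v) :=
      hs2.tsum_le_tsum h2 hs2'
    -- step 3: through the inner composition, then Tonelli in `(u′, v)`
    have h4 : ∀ v, rowFn (comp V B) 0 x v * (ω' * e' v) ≤ (∑' u', rowFn V 0 x u' * rowFn B 0 u' v) * (ω' * e' v) := fun v =>
      mul_le_mul_of_nonneg_right (rowFn_comp_le le_rfl (hprodVB x v)) (mul_nonneg hω' (Real.exp_pos _).le)
    set f : Site D → Site D → ℝ := fun u' v => rowFn V 0 x u' * rowFn B 0 u' v * (ω' * e' v) with hf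
    have hf0 : 0 ≤ Function.uncurry f := fun q =>
      mul_nonneg (mul_nonneg (rowFn_nonneg _ _ _ _) (rowFn_nonneg _ _ _ _)) (mul_nonneg hω' (Real.exp_pos _).le)
    have hfrow : ∀ u', (fun v => f u' v) = fun v => (rowFn V 0 x u' * ω') * (rowFn B 0 u' v * e' v) := fun u' => by
      funext v; rw [hf]; ring
    have hsec1 : ∀ u', Summable fun v => Function.uncurry f (u', v) := fun u' => by
      show Summable fun v => f u' v
      rw [hfrow]; exact (hΦs u').mul_left _
    have hsum1 : ∀ u', ∑' v, f u' v = rowFn V 0 x u' * (ω' * Φ u') := fun u' => by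
      rw [hfrow u', tsum_mul_left, hΦ]; ring
    have hF : Summable (Function.uncurry f) :=
      (summable_prod_of_nonneg hf0).2 ⟨hsec1, by simp_rw [show ∀ u', ∑' v, Function.uncurry f (u', v) = ∑' v, f u' v from fun _ => rfl, hsum1]; exact hRs x⟩
    have hsec2 : ∀ v, Summable fun u' => f u' v := fun v => (hprodVB x v).mul_right (ω' * e' v)
    have hcol2 : Summable fun v => ∑' u', f u' v := by
      have h := ((summable_prod_of_nonneg (f := fun q : Site D × Site D => Function.uncurry f q.swap) (fun q => hf0 q.swap)).1 hF.prod_symm).2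
      exact h
    have hswap : ∑' v, ∑' u', f u' v = ∑' u', ∑' v, f u' v := hF.tsum_comm' (fun u' => hsec1 u') hsec2
    have e4 : ∀ v, (∑' u', rowFn V 0 x u' * rowFn B 0 u' v) * (ω' * e' v) = ∑' u', f u' v := fun v => by
      rw [← tsum_mul_right]
    have hs4 : Summable fun v => (∑' u', rowFn V 0 x u' * rowFn B 0 u' v) * (ω' * e' v) := by
      simp_rw [e4]; exact hcol2
    calc ∑ z ∈ S, rowFn (comp (comp V B) V') 0 x z ≤ _ := h1
      _ ≤ _ := h3
      _ ≤ ∑' v, (∑' u', rowFn V 0 x u' * rowFn B 0 u' v) * (ω' * e' v) := hs2'.tsum_le_tsum h4 hs4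
      _ = ∑' v, ∑' u', f u' v := tsum_congr e4
      _ = ∑' u', ∑' v, f u' v := hswap
      _ = ∑' u', rowFn V 0 x u' * (ω' * Φ u') := tsum_congr hsum1
  -- the rows: summable, with sums `≤ R x`
  have hWrow : ∀ x, Summable (rowFn (comp (comp V B) V') 0 x) := fun x => summable_of_sum_le (fun z => rowFn_nonneg _ _ _ _) (hrow x)
  have hWle : ∀ x, ∑' z, rowFn (comp (comp V B) V') 0 x z ≤ ∑' u', rowFn V 0 x u' * (ω' * Φ u') := fun x =>
    Real.tsum_le_of_sum_le (fun z => rowFn_nonneg _ _ _ _) (hrow x)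
  -- the sum over the rows: the column envelope of `V`, then the θ-bound of `Φ`
  have hfinal : ∀ S' : Finset (Site D), ∑ x ∈ S', ∑' z, rowFn (comp (comp V B) V') 0 x z
      ≤ ω * ω' * MB * Zl D (κ - θ) * Real.exp (-θ * l1 (c - c')) := by
    intro S'
    have h1 : ∑ x ∈ S', ∑' z, rowFn (comp (comp V B) V') 0 x z ≤ ∑' u', (∑ x ∈ S', rowFn V 0 x u') * (ω' * Φ u') := by
      have ha : ∑ x ∈ S', ∑' z, rowFn (comp (comp V B) V') 0 x z ≤ ∑ x ∈ S', ∑' u', rowFn V 0 x u' * (ω' * Φ u') :=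
        Finset.sum_le_sum fun x _ => hWle x
      rw [← Summable.tsum_finsetSum (fun x _ => hRs x)] at ha
      exact ha.trans (le_of_eq (tsum_congr fun u' => by rw [Finset.sum_mul]))
    have h2 : ∀ u', (∑ x ∈ S', rowFn V 0 x u') * (ω' * Φ u') ≤ (ω * e u') * (ω' * Φ u') := fun u' =>
      mul_le_mul_of_nonneg_right (((hVcol u').1.sum_le_tsum S' fun x _ => rowFn_nonneg _ _ _ _).trans (hVcol u').2)
        (mul_nonneg hω' (hΦ0 u'))
    have h3 : ∀ u', (ω * e u') * (ω' * Φ u') ≤ ω * ω' * (MB * Real.exp (-θ * l1 (c - c')) * Real.exp (-(κ - θ) * l1 (u' - c))) := fun u' => by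
      calc (ω * e u') * (ω' * Φ u') = ω * ω' * (e u' * Φ u') := by ring
        _ ≤ _ := mul_le_mul_of_nonneg_left (hΦle u') (mul_nonneg hω hω')
    have hs1 : Summable fun u' => (∑ x ∈ S', rowFn V 0 x u') * (ω' * Φ u') := by
      have : (fun u' => (∑ x ∈ S', rowFn V 0 x u') * (ω' * Φ u')) = fun u' => ∑ x ∈ S', rowFn V 0 x u' * (ω' * Φ u') := by
        funext u'; rw [Finset.sum_mul]
      rw [this]; exact summable_sum fun x _ => hRs x
    have hs3 : Summable fun u' => ω * ω' * (MB * Real.exp (-θ * l1 (c - c')) * Real.exp (-(κ - θ) * l1 (u' - c))) :=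
      ((summable_exp_shift' (D := D) (by linarith : 0 < κ - θ) c).mul_left (MB * Real.exp (-θ * l1 (c - c')))).mul_left (ω * ω')
    have hs2 : Summable fun u' => (ω * e u') * (ω' * Φ u') :=
      hs3.of_nonneg_of_le (fun u' => mul_nonneg (mul_nonneg hω (Real.exp_pos _).le) (mul_nonneg hω' (hΦ0 u'))) h3
    calc ∑ x ∈ S', ∑' z, rowFn (comp (comp V B) V') 0 x z ≤ _ := h1
      _ ≤ ∑' u', (ω * e u') * (ω' * Φ u') := hs1.tsum_le_tsum h2 hs2
      _ ≤ ∑' u', ω * ω' * (MB * Real.exp (-θ * l1 (c - c')) * Real.exp (-(κ - θ) * l1 (u' - c))) := hs2.tsum_le_tsum h3 hs3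
      _ = ω * ω' * (MB * Real.exp (-θ * l1 (c - c')) * ∑' u', Real.exp (-(κ - θ) * l1 (u' - c))) := by
          rw [tsum_mul_left, tsum_mul_left]
      _ = ω * ω' * MB * Zl D (κ - θ) * Real.exp (-θ * l1 (c - c')) := by rw [tsum_exp_shift']; ring
  have hnn : ∀ x, 0 ≤ ∑' z, rowFn (comp (comp V B) V') 0 x z := fun x => tsum_nonneg fun z => rowFn_nonneg _ _ _ _
  exact totMass_iff.2 ⟨hWrow, summable_of_sum_le hnn hfinal, Real.tsum_le_of_sum_le hnn hfinal⟩

end Summit.QuantumFields.BalabanUV.Beta.D1BFx.KernelMassTotal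

end
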